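import Mathlib
import Summits.NavierStokesRegularity.NavierStokesRegularity.Theorems.HeteroclinicTriggerChainTriggerChainFrontStepNormalForm
import HarnessLib

/-!
# `HeteroclinicTriggerChain` — crux `TriggerChainFrontStep` (item stmt-NavierStokesRegularity-22785):
  the JUNK ROWS of the cascade nonlinearity for ARBITRARY families

Companion to `…CarrierRow` (carrier rows = signed squares) and `…TriggerRow` (trigger rows linear in the
triggers). For a junk mode `j ∉ {i₀, i₁}` of a table in normal form with the (parity) clause, and an
ARBITRARY family `X`, the row `(j, n)` reads

  `quadTerm 1 α X j n = 2^{5n/2}·( b_j·u_n² + (λ¹_j + λ²_j)·u_{n+1}u_n + (d_j·x_n − g_j·x_{n+1})·p_{j,n} + JJ₀ )`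
  `                    + 2^{5(n−1)/2}·( b′_j·u_{n−1}² + JJ₋ )`

(`htcJR_quadTerm_junk`): the trigger self-interaction `b_j = α i₁ i₁ j (0,0,0)`, `b′_j = α i₁ i₁ j (0,0,1)`
(both vanish on the junk-free class, `…ConnectionArc`), the OVERLAP TRIAD `λ¹_j + λ²_j =
α i₁ i₁ j (1,0,0) + α i₁ i₁ j (0,1,0)` (the only O(1) source of junk on a running chain: `u_{n+1}u_n`),
the carrier coupling `d_j x_n − g_j x_{n+1}` (`d_j = d j 0 ≤ 0`, `g_j = α j j i₀ (0,0,1) ≥ 0`: DAMPING while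
the carriers are nonnegative — no coupling to `p_{j,n±1}` through the carrier), and junk × junk blocks
`JJ₀`, `JJ₋` (sums over pairs of junk modes, bounded by `12ι²` and `4ι²` when the junk amplitudes at shells
`n−1, n, n+1` are `≤ ι`: `htcJR_junkBlock_abs_le`). This is the input of the junk ENVELOPE (the `ι` of the
lattice hop lemmas `…LatticeDelay/Capture/Seed`).

HONEST FRAMING: finite algebra of structure constants of Tao-type MODEL lattices (Tao 2016 §4); helper for
the crux (no stub credit); nothing here is a statement about the Navier–Stokes equations; no summit,
rung or crux is proved by this file.
-/

noncomputable section

set_option linter.dupNamespace false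

namespace Summit.NavierStokesRegularity.NavierStokesRegularity.Theorems

open Literature.Analysis.FluidPDE Literature.Analysis.FluidPDE.TaoCascade

/-- A double sum over `Fin 4 × Fin 4` of a summand vanishing when EXACTLY ONE index is `i₁` splits into
the diagonal term `(i₁,i₁)` and the block avoiding `i₁`. [folklore] -/
theorem htcJR_sum_parity_even (f : Fin 4 → Fin 4 → ℝ) (i₁ : Fin 4)
    (hf : ∀ a b, Xor (a = i₁) (b = i₁) → f a b = 0) :
    ∑ a, ∑ b, f a b = f i₁ i₁ + ∑ a, ∑ b, (if a ≠ i₁ ∧ b ≠ i₁ then f a b else 0) := by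
  have hpt : ∀ a b, f a b =
      (if a = i₁ ∧ b = i₁ then f a b else 0) + (if a ≠ i₁ ∧ b ≠ i₁ then f a b else 0) := by
    intro a b
    by_cases ha : a = i₁
    · by_cases hb : b = i₁
      · rw [if_pos ⟨ha, hb⟩, if_neg (fun h => h.1 ha), add_zero]
      · rw [if_neg (fun h => hb h.2), if_neg (fun h => h.1 ha), add_zero]
        exact hf a b (Or.inl ⟨ha, hb⟩)
    · by_cases hb : b = i₁
      · rw [if_neg (fun h => ha h.1), if_neg (fun h => h.2 hb), add_zero]
        exact hf a b (Or.inr ⟨hb, ha⟩)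
      · rw [if_neg (fun h => ha h.1), if_pos ⟨ha, hb⟩, zero_add]
  rw [Finset.sum_congr rfl fun a _ => Finset.sum_congr rfl fun b _ => hpt a b]
  simp only [Finset.sum_add_distrib]
  congr 1
  rw [Finset.sum_eq_single i₁ (fun a _ ha => by simp [ha]) (by simp)]
  rw [Finset.sum_eq_single i₁ (fun b _ hb => by simp [hb]) (by simp)]
  simp

/-- Inside the block avoiding `i₁`, split off the carrier row and column: for a summand supported (in
its first index) away from `i₁`, `∑_{a ≠ i₁} g a = g i₀ + ∑_{a ∉ {i₀,i₁}} g a`. [folklore] -/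
theorem htcJR_sum_avoid_split (g : Fin 4 → ℝ) {i₀ i₁ : Fin 4} (hne : i₀ ≠ i₁) :
    ∑ a, (if a ≠ i₁ then g a else 0) = g i₀ + ∑ a, (if a ≠ i₀ ∧ a ≠ i₁ then g a else 0) := by
  have hpt : ∀ a, (if a ≠ i₁ then g a else 0) =
      (if a = i₀ then g a else 0) + (if a ≠ i₀ ∧ a ≠ i₁ then g a else 0) := by
    intro a
    by_cases ha0 : a = i₀
    · simp [ha0, hne]
    · by_cases ha1 : a = i₁
      · simp [ha1, hne.symm]
      · simp [ha0, ha1]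
  rw [Finset.sum_congr rfl fun a _ => hpt a, Finset.sum_add_distrib]
  simp

/-- Pulling a restricted double sum apart: `∑_a ∑_b [a ≠ i₁ ∧ b ≠ i₁] f a b = ∑_a [a ≠ i₁] (∑_b [b ≠ i₁] f a b)`.
[folklore] -/
theorem htcJR_sum_restrict_nest (f : Fin 4 → Fin 4 → ℝ) (i₁ : Fin 4) :
    ∑ a, ∑ b, (if a ≠ i₁ ∧ b ≠ i₁ then f a b else 0) =
      ∑ a, (if a ≠ i₁ then ∑ b, (if b ≠ i₁ then f a b else 0) else 0) := by
  refine Finset.sum_congr rfl fun a _ => ?_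
  by_cases ha : a = i₁
  · simp [ha]
  · simp [ha]

/-- The junk × junk block of a row: the double sum over pairs of junk modes (`∉ {i₀, i₁}`). A plain
abbreviation-free expression (an indicator double sum), so that no definition is introduced. [folklore] -/
theorem htcJR_junkBlock_abs_le (F : Fin 4 → Fin 4 → ℝ) {i₀ i₁ : Fin 4} {B : ℝ} (hB0 : 0 ≤ B)
    (hB : ∀ a b, a ≠ i₀ → a ≠ i₁ → b ≠ i₀ → b ≠ i₁ → |F a b| ≤ B) :
    |∑ a, ∑ b, (if (a ≠ i₀ ∧ a ≠ i₁) ∧ (b ≠ i₀ ∧ b ≠ i₁) then F a b else 0)| ≤ 16 * B := by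
  have hterm : ∀ a b, |(if (a ≠ i₀ ∧ a ≠ i₁) ∧ (b ≠ i₀ ∧ b ≠ i₁) then F a b else 0)| ≤ B := by
    intro a b
    split_ifs with h
    · exact hB a b h.1.1 h.1.2 h.2.1 h.2.2
    · simpa using hB0
  calc |∑ a, ∑ b, (if (a ≠ i₀ ∧ a ≠ i₁) ∧ (b ≠ i₀ ∧ b ≠ i₁) then F a b else 0)|
      ≤ ∑ a, |∑ b, (if (a ≠ i₀ ∧ a ≠ i₁) ∧ (b ≠ i₀ ∧ b ≠ i₁) then F a b else 0)| :=
        Finset.abs_sum_le_sum_abs _ _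
    _ ≤ ∑ a, ∑ b, |(if (a ≠ i₀ ∧ a ≠ i₁) ∧ (b ≠ i₀ ∧ b ≠ i₁) then F a b else 0)| :=
        Finset.sum_le_sum fun a _ => Finset.abs_sum_le_sum_abs _ _
    _ ≤ ∑ _a : Fin 4, ∑ _b : Fin 4, B := Finset.sum_le_sum fun a _ => Finset.sum_le_sum fun b _ => hterm a b
    _ = 16 * B := by simp; ring

/-- **JUNK ROW FOR ARBITRARY FAMILIES.** For a table in normal form at `i₀` (symmetric, cancelling, pure
`i₀`-families force-free, diagonal polarisation `d`) with the (parity) clause at `i₁ ≠ i₀`, a junk mode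
`j ∉ {i₀, i₁}`, an ARBITRARY family `X` and a shell `n`:
`quadTerm 1 α X j n = 2^{5n/2}( b_j u_n² + (λ¹_j+λ²_j) u_{n+1}u_n + (d_j x_n − g_j x_{n+1}) p_{j,n} + JJ₀ )
+ 2^{5(n−1)/2}( b′_j u_{n−1}² + JJ₋ )` with `b_j = α i₁ i₁ j (0,0,0)`, `λ¹_j = α i₁ i₁ j (1,0,0)`,
`λ²_j = α i₁ i₁ j (0,1,0)`, `b′_j = α i₁ i₁ j (0,0,1)`, `d_j = d j 0`, `g_j = α j j i₀ (0,0,1)`, and the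
junk × junk indicator blocks `JJ₀`, `JJ₋` written out. [this file] -/
theorem htcJR_quadTerm_junk (α : Fin 4 → Fin 4 → Fin 4 → ℤ × ℤ × ℤ → ℝ) (i₀ i₁ j : Fin 4)
    (d : Fin 4 → ℤ → ℝ) (hne : i₀ ≠ i₁) (hj0 : j ≠ i₀) (hj1 : j ≠ i₁)
    (hsym : IsSymmetricCoeff α) (hcanc : IsCancellingCoeff α)
    (hpure : ∀ X : Fin 4 → ℤ → ℝ → ℝ, (∀ i n t, i ≠ i₀ → X i n t = 0) →
      ∀ i n t, quadTerm 1 α X i n t = 0)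
    (hsad : ∀ (Y : Fin 4 → ℤ → ℝ → ℝ) (i : Fin 4) (n : ℤ) (t : ℝ),
      quadTerm 1 α (fun j m s => (fun j m (_ : ℝ) => if j = i₀ ∧ m = 0 then (1 : ℝ) else 0) j m s +
          Y j m s) i n t -
        quadTerm 1 α (fun j m (_ : ℝ) => if j = i₀ ∧ m = 0 then (1 : ℝ) else 0) i n t -
        quadTerm 1 α Y i n t = d i n * Y i n t)
    (hpar : ∀ (j₁ j₂ j₃ : Fin 4) (μ : ℤ × ℤ × ℤ),
      Xor (Xor (j₁ = i₁) (j₂ = i₁)) (j₃ = i₁) → α j₁ j₂ j₃ μ = 0)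
    (X : Fin 4 → ℤ → ℝ → ℝ) (n : ℤ) (t : ℝ) :
    quadTerm 1 α X j n t =
      (1 + 1 : ℝ) ^ ((5 : ℝ) * n / 2) *
          (α i₁ i₁ j (0, 0, 0) * X i₁ n t ^ 2 +
            (α i₁ i₁ j (1, 0, 0) + α i₁ i₁ j (0, 1, 0)) * (X i₁ (n + 1) t * X i₁ n t) +
            (d j 0 * X i₀ n t - α j j i₀ (0, 0, 1) * X i₀ (n + 1) t) * X j n t +
            ∑ a, ∑ b, (if (a ≠ i₀ ∧ a ≠ i₁) ∧ (b ≠ i₀ ∧ b ≠ i₁) then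
              α a b j (0, 0, 0) * (X a n t * X b n t) + α a b j (1, 0, 0) * (X a (n + 1) t * X b n t) +
                α a b j (0, 1, 0) * (X a n t * X b (n + 1) t) else 0)) +
        (1 + 1 : ℝ) ^ ((5 : ℝ) * ((n : ℝ) - 1) / 2) *
          (α i₁ i₁ j (0, 0, 1) * X i₁ (n - 1) t ^ 2 +
            ∑ a, ∑ b, (if (a ≠ i₀ ∧ a ≠ i₁) ∧ (b ≠ i₀ ∧ b ≠ i₁) then
              α a b j (0, 0, 1) * (X a (n - 1) t * X b (n - 1) t) else 0)) := by
  obtain ⟨nf1, nf2, nf3, nf4, -, -, -, -, nf9⟩ :=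
    HeteroclinicTriggerChain.stub_normal_form α i₀ d hsym hcanc hpure hsad
  have m000 : ((0 : ℤ), (0 : ℤ), (0 : ℤ)) ∈ shiftSet := by decide
  have m100 : ((1 : ℤ), (0 : ℤ), (0 : ℤ)) ∈ shiftSet := by decide
  have m010 : ((0 : ℤ), (1 : ℤ), (0 : ℤ)) ∈ shiftSet := by decide
  have m001 : ((0 : ℤ), (0 : ℤ), (1 : ℤ)) ∈ shiftSet := by decide
  have sym000 : ∀ a b c : Fin 4, α a b c (0, 0, 0) = α b a c (0, 0, 0) :=
    fun a b c => hsym a b c 0 0 0 m000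
  -- parity on a junk row: entries with exactly one trigger input vanish
  have hz : ∀ (a b : Fin 4) (μ : ℤ × ℤ × ℤ), Xor (a = i₁) (b = i₁) → α a b j μ = 0 := by
    intro a b μ hab
    refine hpar a b j μ ?_
    rcases hab with ⟨ha, hb⟩ | ⟨hb, ha⟩
    · simp [Xor, ha, hb, hj1]
    · simp [Xor, ha, hb, hj1]
  -- generic block evaluation: a double sum restricted away from i₁ whose carrier row/column reduce to
  -- the single entries (i₀, j), (j, i₀)
  have hblock : ∀ (F : Fin 4 → Fin 4 → ℝ),
      F i₀ i₀ = 0 → (∀ b, b ≠ i₀ → b ≠ i₁ → b ≠ j → F i₀ b = 0) →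
      (∀ a, a ≠ i₀ → a ≠ i₁ → a ≠ j → F a i₀ = 0) →
      ∑ a, ∑ b, (if a ≠ i₁ ∧ b ≠ i₁ then F a b else 0) =
        F i₀ j + F j i₀ + ∑ a, ∑ b, (if (a ≠ i₀ ∧ a ≠ i₁) ∧ (b ≠ i₀ ∧ b ≠ i₁) then F a b else 0) := by
    intro F hF00 hrow hcol
    rw [htcJR_sum_restrict_nest, htcJR_sum_avoid_split _ hne]
    -- the carrier row
    have hg0 : ∑ b, (if b ≠ i₁ then F i₀ b else 0) = F i₀ j := by
      rw [htcJR_sum_avoid_split _ hne, hF00, zero_add]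
      rw [Finset.sum_eq_single j (fun b _ hb => ?_) (by simp)]
      · simp [hj0, hj1]
      · by_cases hb0 : b = i₀
        · simp [hb0]
        · by_cases hb1 : b = i₁
          · simp [hb1]
          · simp [hb0, hb1, hrow b hb0 hb1 hb]
    -- the junk rows
    have hga : ∀ a, a ≠ i₀ → a ≠ i₁ → ∑ b, (if b ≠ i₁ then F a b else 0) =
        F a i₀ + ∑ b, (if b ≠ i₀ ∧ b ≠ i₁ then F a b else 0) := fun a _ _ =>
      htcJR_sum_avoid_split _ hne
    have hsum : ∑ a, (if a ≠ i₀ ∧ a ≠ i₁ then ∑ b, (if b ≠ i₁ then F a b else 0) else 0) =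
        ∑ a, (if a ≠ i₀ ∧ a ≠ i₁ then F a i₀ else 0) +
          ∑ a, ∑ b, (if (a ≠ i₀ ∧ a ≠ i₁) ∧ (b ≠ i₀ ∧ b ≠ i₁) then F a b else 0) := by
      rw [← Finset.sum_add_distrib]
      refine Finset.sum_congr rfl fun a _ => ?_
      by_cases ha : a ≠ i₀ ∧ a ≠ i₁
      · rw [if_pos ha, if_pos ha, hga a ha.1 ha.2]
        congr 1
        refine Finset.sum_congr rfl fun b _ => ?_
        by_cases hb : b ≠ i₀ ∧ b ≠ i₁
        · rw [if_pos hb, if_pos ⟨ha, hb⟩]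
        · rw [if_neg hb, if_neg (fun h => hb h.2)]
      · rw [if_neg ha, if_neg ha, zero_add]
        symm
        refine Finset.sum_eq_zero fun b _ => ?_
        rw [if_neg (fun h => ha h.1)]
    have hcol' : ∑ a, (if a ≠ i₀ ∧ a ≠ i₁ then F a i₀ else 0) = F j i₀ := by
      rw [Finset.sum_eq_single j (fun a _ ha => ?_) (by simp)]
      · simp [hj0, hj1]
      · by_cases ha0 : a = i₀
        · simp [ha0]
        · by_cases ha1 : a = i₁
          · simp [ha1]
          · simp [ha0, ha1, hcol a ha0 ha1 ha]
    rw [hg0, hsum, hcol']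
    ring
  rw [htcNF_quadTerm_expand]
  -- ===== the same-shell / back-reaction block =====
  set F : Fin 4 → Fin 4 → ℝ := fun a b =>
    α a b j (0, 0, 0) * (X a n t * X b n t) + α a b j (1, 0, 0) * (X a (n + 1) t * X b n t) +
      α a b j (0, 1, 0) * (X a n t * X b (n + 1) t) with hF
  have hF0 : ∀ a b, Xor (a = i₁) (b = i₁) → F a b = 0 := by
    intro a b hab
    simp only [hF, hz a b _ hab, zero_mul, add_zero]
  have hF00 : F i₀ i₀ = 0 := by
    simp only [hF, nf1 j _ m000, nf1 j _ m100, nf1 j _ m010, zero_mul, add_zero]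
  have hFrow : ∀ b, b ≠ i₀ → b ≠ i₁ → b ≠ j → F i₀ b = 0 := by
    intro b _ _ hbj
    simp only [hF, (nf3 b j hbj).1, (nf3 b j hbj).2.2.1, (nf2 b j).2.2.2, zero_mul, add_zero]
  have hFcol : ∀ a, a ≠ i₀ → a ≠ i₁ → a ≠ j → F a i₀ = 0 := by
    intro a _ _ haj
    simp only [hF, (nf3 a j haj).2.1, (nf2 a j).2.2.1, (nf3 a j haj).2.2.2, zero_mul, add_zero]
  have hFi0j : F i₀ j = d j 0 / 2 * X i₀ n t * X j n t -
      α j j i₀ (0, 0, 1) / 2 * X i₀ (n + 1) t * X j n t := by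
    simp only [hF]
    rw [(nf9 j).2.1, (nf2 j j).2.2.2, nf4 j]
    ring
  have hFji0 : F j i₀ = d j 0 / 2 * X i₀ n t * X j n t -
      α j j i₀ (0, 0, 1) / 2 * X i₀ (n + 1) t * X j n t := by
    simp only [hF]
    rw [sym000 j i₀ j, (nf2 j j).2.2.1, (nf9 j).2.2.1, nf4 j]
    ring
  have hblockF := hblock F hF00 hFrow hFcol
  have hsplitF := htcJR_sum_parity_even F i₁ hF0
  -- ===== the pump block =====
  set G : Fin 4 → Fin 4 → ℝ := fun a b => α a b j (0, 0, 1) * (X a (n - 1) t * X b (n - 1) t) with hG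
  have hG0 : ∀ a b, Xor (a = i₁) (b = i₁) → G a b = 0 := by
    intro a b hab
    simp only [hG, hz a b _ hab, zero_mul]
  have hG00 : G i₀ i₀ = 0 := by simp only [hG, nf1 j _ m001, zero_mul]
  have hGrow : ∀ b, b ≠ i₀ → b ≠ i₁ → b ≠ j → G i₀ b = 0 := by
    intro b _ _ _; simp only [hG, (nf2 b j).1, zero_mul]
  have hGcol : ∀ a, a ≠ i₀ → a ≠ i₁ → a ≠ j → G a i₀ = 0 := by
    intro a _ _ _; simp only [hG, (nf2 a j).2.1, zero_mul]
  have hGi0j : G i₀ j = 0 := by simp only [hG, (nf2 j j).1, zero_mul]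
  have hGji0 : G j i₀ = 0 := by simp only [hG, (nf2 j j).2.1, zero_mul]
  have hblockG := hblock G hG00 hGrow hGcol
  have hsplitG := htcJR_sum_parity_even G i₁ hG0
  -- assemble
  have hsumF : ∑ a, ∑ b, (α a b j (0, 0, 0) * (X a n t * X b n t) +
      α a b j (1, 0, 0) * (X a (n + 1) t * X b n t) + α a b j (0, 1, 0) * (X a n t * X b (n + 1) t)) =
      ∑ a, ∑ b, F a b := rfl
  have hsumG : ∑ a, ∑ b, α a b j (0, 0, 1) * (X a (n - 1) t * X b (n - 1) t) = ∑ a, ∑ b, G a b := rfl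
  rw [hsumF, hsumG, hsplitF, hsplitG, hblockF, hblockG, hFi0j, hFji0, hGi0j, hGji0]
  simp only [hF, hG]
  ring

end Summit.NavierStokesRegularity.NavierStokesRegularity.Theorems

end
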